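import Mathlib
import HarnessLib
import Summits.SmoothPoincare4.SmoothPoincare4.Theses.EntropyRung
import Summits.SmoothPoincare4.SmoothPoincare4.Theses.RicciFat

/-!
# Sketch — crux ideas for `EntropyRung.SubcylindricalExistence` (stmt-SmoothPoincare4-10871)

First lemmas of the idea card `curvature-dimension-entropy-floor` (crux-ideate round 1, ideator 2).
Nothing here is proved; the point is that the statements elaborate over existing declarations.
-/

namespace Summit.SmoothPoincare4.SmoothPoincare4.Cruxes.SubcylindricalExistence.CurvatureDimensionEntropyFloor

open scoped Manifold ContDiff
open MeasureTheory

/-- FIRST LEMMA (Theorem A, entropy ≥ log-volume under `Ric ≥ 3`).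
For a closed connected Riemannian 4-manifold with `Ric_g ≥ 3 g` one has, for every `τ > 0` and every
smooth `f` with `∫ (4πτ)⁻² e^{-f} dV = 1`,
`𝒲(g,f,τ) ≥ log Vol(M,g) − 2 log(2π/3) − 2`, i.e. `μ(g,τ) ≥ μ(S⁴_rd,τ) + log(Vol/Vol S⁴) ≥ ν(S⁴_rd) + log(Vol/Vol S⁴)`
with `ν(S⁴_rd) = log 6 − 2 = log(8π²/3) − 2 log(2π/3) − 2`.  Equality for every Einstein metric with
`Ric = 3g` (Carrillo–Ni).  Proof route: Lévy–Gromov isoperimetric comparison + Bérard–Besson–Gallot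
spherical symmetrisation of the competitors of `𝒲`, `R ≥ 12`, and RoundBound `μ(S⁴_rd,τ) ≥ log 6 − 2`. -/
def EntropyVolumeComparison : Prop :=
  ∀ (M : Type) [TopologicalSpace M] [T2Space M] [SecondCountableTopology M]
    [ChartedSpace (EuclideanSpace ℝ (Fin 4)) M] [IsManifold (𝓡 4) ∞ M] [CompactSpace M] [T3Space M]
    [MeasurableSpace M] [BorelSpace M] [ConnectedSpace M]
    (g : Literature.Geometry.Lorentzian.PseudoRiemannianMetric (𝓡 4) ∞ (EuclideanSpace ℝ (Fin 4))
      (TangentSpace (𝓡 4) : M → Type _)) [g.HasLeviCivita] (hg : g.IsRiemannian),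
    (∀ (x : M) (v : TangentSpace (𝓡 4) x), 3 * g.val x v v ≤ g.ricci x v v) →
    ∀ τ : ℝ, 0 < τ → ∀ f : M → ℝ, ContMDiff (𝓡 4) 𝓘(ℝ, ℝ) ∞ f →
      ∫ x, (4 * Real.pi * τ) ^ (-(4 : ℝ) / 2) * Real.exp (-f x)
          ∂(Literature.Geometry.Lorentzian.riemannianMeasure (g.toContMDiffRiemannianMetric hg)) = 1 →
      Real.log ((Literature.Geometry.Lorentzian.riemannianMeasure (g.toContMDiffRiemannianMetric hg)
          Set.univ).toReal) - 2 * Real.log (2 * Real.pi / 3) - 2 ≤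
        ∫ x, (τ * (g.scalarCurvature x + g.gradSq f x) + f x - 4) *
          ((4 * Real.pi * τ) ^ (-(4 : ℝ) / 2) * Real.exp (-f x))
          ∂(Literature.Geometry.Lorentzian.riemannianMeasure (g.toContMDiffRiemannianMetric hg))

/-- ROUND BOUND as the special case `g = round`, stated fact-free: the scale-family of sharp
log-Sobolev inequalities on the unit round `S⁴` — for every closed connected Riemannian 4-manifold
with `Ric = 3g` (in particular the round unit sphere) `μ(g,τ) ≥ log Vol − 2 log(2π/3) − 2` for all `τ`.
(Sub-statement of `EntropyVolumeComparison`; listed separately because it is what certifies that the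
hypothesis class of `SubcylindricalRecognition` is non-empty and is closable now.) -/
def EinsteinRoundBound : Prop :=
  ∀ (M : Type) [TopologicalSpace M] [T2Space M] [SecondCountableTopology M]
    [ChartedSpace (EuclideanSpace ℝ (Fin 4)) M] [IsManifold (𝓡 4) ∞ M] [CompactSpace M] [T3Space M]
    [MeasurableSpace M] [BorelSpace M] [ConnectedSpace M]
    (g : Literature.Geometry.Lorentzian.PseudoRiemannianMetric (𝓡 4) ∞ (EuclideanSpace ℝ (Fin 4))
      (TangentSpace (𝓡 4) : M → Type _)) [g.HasLeviCivita] (hg : g.IsRiemannian),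
    (∀ (x : M) (v w : TangentSpace (𝓡 4) x), g.ricci x v w = 3 * g.val x v w) →
    ∀ τ : ℝ, 0 < τ → ∀ f : M → ℝ, ContMDiff (𝓡 4) 𝓘(ℝ, ℝ) ∞ f →
      ∫ x, (4 * Real.pi * τ) ^ (-(4 : ℝ) / 2) * Real.exp (-f x)
          ∂(Literature.Geometry.Lorentzian.riemannianMeasure (g.toContMDiffRiemannianMetric hg)) = 1 →
      Real.log ((Literature.Geometry.Lorentzian.riemannianMeasure (g.toContMDiffRiemannianMetric hg)
          Set.univ).toReal) - 2 * Real.log (2 * Real.pi / 3) - 2 ≤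
        ∫ x, (τ * (g.scalarCurvature x + g.gradSq f x) + f x - 4) *
          ((4 * Real.pi * τ) ^ (-(4 : ℝ) / 2) * Real.exp (-f x))
          ∂(Literature.Geometry.Lorentzian.riemannianMeasure (g.toContMDiffRiemannianMetric hg))

/-- THE NAMED FACT the first lemma rests on, in the shape a prover needs (dimensional Bakry–Émery /
Bakry–Gentil–Ledoux entropy–energy inequality, case `ρ = 3`, `n = 4`): on a closed connected
Riemannian 4-manifold with `Ric ≥ 3g`, for every smooth `w` with `∫ w² dV = Vol`,
`(1/Vol)∫ w² log w² dV ≤ 2·log(1 + (1/(3·Vol))∫|∇w|² dV)`.  In-tree route: upgrade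
`Literature/Geometry/Riemannian/BakryEmeryHeatFlow.lean` (keep `|Hess f|² ≥ (Δf)²/4` in
`fisher_pointwise_le`, Riccati comparison `y' = −(1/2)y(12 + y)` instead of Grönwall), modulo the same
heat-flow hypothesis `hflow`. -/
def EntropyEnergyCD34 : Prop :=
  ∀ (M : Type) [TopologicalSpace M] [T2Space M] [SecondCountableTopology M]
    [ChartedSpace (EuclideanSpace ℝ (Fin 4)) M] [IsManifold (𝓡 4) ∞ M] [CompactSpace M] [T3Space M]
    [MeasurableSpace M] [BorelSpace M] [ConnectedSpace M]
    (g : Literature.Geometry.Lorentzian.PseudoRiemannianMetric (𝓡 4) ∞ (EuclideanSpace ℝ (Fin 4))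
      (TangentSpace (𝓡 4) : M → Type _)) [g.HasLeviCivita] (hg : g.IsRiemannian),
    (∀ (x : M) (v : TangentSpace (𝓡 4) x), 3 * g.val x v v ≤ g.ricci x v v) →
    ∀ w : M → ℝ, ContMDiff (𝓡 4) 𝓘(ℝ, ℝ) ∞ w →
      ∫ x, w x ^ 2 ∂(Literature.Geometry.Lorentzian.riemannianMeasure (g.toContMDiffRiemannianMetric hg))
        = (Literature.Geometry.Lorentzian.riemannianMeasure (g.toContMDiffRiemannianMetric hg)
            Set.univ).toReal →
      (∫ x, w x ^ 2 * Real.log (w x ^ 2)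
          ∂(Literature.Geometry.Lorentzian.riemannianMeasure (g.toContMDiffRiemannianMetric hg)))
        / (Literature.Geometry.Lorentzian.riemannianMeasure (g.toContMDiffRiemannianMetric hg)
            Set.univ).toReal ≤
      2 * Real.log (1 + (∫ x, g.gradSq w x
          ∂(Literature.Geometry.Lorentzian.riemannianMeasure (g.toContMDiffRiemannianMetric hg)))
          / (3 * (Literature.Geometry.Lorentzian.riemannianMeasure (g.toContMDiffRiemannianMetric hg)
            Set.univ).toReal))

/-- TRANSFER.  The existence crux of route RicciFat implies the existence crux ENT of route EntropyRung:
`RicciFatSphere` at `δ := 1 − √(π e)/3 ≈ 0.0259` gives `Ric ≥ 3`, `Vol > e^{ν_cyl − ν_rd}·8π²/3`, hence by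
`EntropyVolumeComparison` `ν(g) > ν_cyl` (with the ENT-`δ` equal to `log Vol − log(0.97409·8π²/3) > 0`)
and `R ≥ 12 > 0`. -/
def RicciFatImpliesSubcylindricalExistence : Prop :=
  Summit.SmoothPoincare4.SmoothPoincare4.Theses.RicciFat.RicciFatSphere →
    Summit.SmoothPoincare4.SmoothPoincare4.Theses.EntropyRung.SubcylindricalExistence

/-- The numerical heart of the transfer: the volume threshold is `e^{ν_cyl − ν_rd} = √(π e)/3`. -/
theorem threshold_identity :
    Real.exp ((Real.log 2 + Real.log Real.pi / 2 - 3 / 2) - (Real.log 6 - 2))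
      = Real.sqrt Real.pi * Real.exp (1 / 2 : ℝ) / 3 := by
  have hpi : (0 : ℝ) < Real.pi := Real.pi_pos
  have h6 : Real.log 6 = Real.log 2 + Real.log 3 := by
    rw [show (6 : ℝ) = 2 * 3 by norm_num, Real.log_mul (by norm_num) (by norm_num)]
  rw [h6]
  have : (Real.log 2 + Real.log Real.pi / 2 - 3 / 2) - (Real.log 2 + Real.log 3 - 2)
      = Real.log Real.pi / 2 + 1 / 2 - Real.log 3 := by ring
  rw [this, show Real.log Real.pi / 2 + 1 / 2 - Real.log 3
      = (Real.log Real.pi / 2) + (1 / 2) - Real.log 3 by ring]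
  rw [Real.exp_sub, Real.exp_add, Real.exp_log (by norm_num : (0:ℝ) < 3)]
  congr 1
  rw [Real.sqrt_eq_rpow, Real.rpow_def_of_pos hpi]
  congr 1
  ring

end Summit.SmoothPoincare4.SmoothPoincare4.Cruxes.SubcylindricalExistence.CurvatureDimensionEntropyFloor
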